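import Summits.AtomisticToContinuum.HydrodynamicLimit.Theorems.AnnealedZeroHorizonDefs
import Literature.MathematicalPhysics.KineticTheory.HardSphereEulerProofs
import Literature.Analysis.FluidPDE.HardSphereTorusMeasure
import Mathlib

/-!
# Crux `AnnealedWeakStrong` (stmt-AtomisticToContinuum-9258), line `registered` — toolbox B of the
# coercivity-consumption step S3b (`stub_smallRelEntropyFieldsClose`): integration bookkeeping

Currency-independent integration steps of "pathwise `dist ≤ δ + K · (relative entropy)` ⇒ mean
field distance small" (FjordholmEtAl2020 Lemma 28, last step), for both candidate currencies of the
mean relative entropy (lower integral of `ofReal`, or Bochner integral + integrability):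

* `ofReal_integral_le_add_mul_lintegral`: a pointwise bound `0 ≤ f ≤ δ + K h` on `𝕋³` bounds
  `ofReal (∫ f)` by `ofReal δ + ofReal K · ∫⁻ ofReal h` — no integrability of `f` or `h` needed
  (the Bochner junk value `0` only helps);
* `lintegral_ofReal_le_of_ae_le`, `lintegral_ofReal_le_of_integral_le`: the in-law versions on a
  probability space.

The registered helper stub `s3bIntegrationToolbox` bundles them (in-law versions specialised to the
local Gibbs laws). References: FjordholmEtAl2020 (Lemma 28).
-/

noncomputable section

open MeasureTheory Filter Set Function
open scoped ENNReal Topology InnerProductSpace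

namespace Summit.AtomisticToContinuum.HydrodynamicLimit.Theorems.AWS

open Literature.MathematicalPhysics.KineticTheory Literature.Analysis.FluidPDE

/-! ### Integration bookkeeping -/

/-- **Pathwise integration step.** A pointwise bound `0 ≤ f ≤ δ + K h` on `𝕋³` (`δ, K ≥ 0`) gives
`ofReal (∫ f) ≤ ofReal δ + ofReal K · ∫⁻ ofReal h` — whatever the integrability of `f` and `h`. -/
theorem ofReal_integral_le_add_mul_lintegral {f h : T3 → ℝ} {δ K : ℝ} (hK : 0 ≤ K)
    (hf : ∀ x, 0 ≤ f x) (hle : ∀ x, f x ≤ δ + K * h x) :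
    ENNReal.ofReal (∫ x, f x) ≤
      ENNReal.ofReal δ + ENNReal.ofReal K * ∫⁻ x, ENNReal.ofReal (h x) := by
  -- `ofReal (∫ f) ≤ ∫⁻ ofReal f` for `f ≥ 0` (no integrability needed: the junk value is `0`)
  have h0 : ENNReal.ofReal (∫ x, f x) ≤ ∫⁻ x, ENNReal.ofReal (f x) := by
    by_cases hfi : Integrable f
    · rw [ofReal_integral_eq_lintegral_ofReal hfi (ae_of_all _ hf)]
    · rw [integral_undef hfi, ENNReal.ofReal_zero]; exact bot_le
  calc ENNReal.ofReal (∫ x, f x) ≤ ∫⁻ x, ENNReal.ofReal (f x) := h0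
    _ ≤ ∫⁻ x, ENNReal.ofReal δ + ENNReal.ofReal K * ENNReal.ofReal (h x) :=
        lintegral_mono fun x => by
          calc ENNReal.ofReal (f x) ≤ ENNReal.ofReal (δ + K * h x) := ENNReal.ofReal_le_ofReal (hle x)
            _ ≤ ENNReal.ofReal δ + ENNReal.ofReal (K * h x) := ENNReal.ofReal_add_le
            _ = _ := by rw [ENNReal.ofReal_mul hK]
    _ = ENNReal.ofReal δ + ENNReal.ofReal K * ∫⁻ x, ENNReal.ofReal (h x) := by
        rw [lintegral_add_left measurable_const, lintegral_const, measure_univ, mul_one,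
          lintegral_const_mul' _ _ ENNReal.ofReal_ne_top]

/-- **In-law integration step (lower-integral currency).** -/
theorem lintegral_ofReal_le_of_ae_le {Ω : Type*} [MeasurableSpace Ω] {μ : Measure Ω}
    [IsProbabilityMeasure μ] {F : Ω → ℝ} {G : Ω → ℝ≥0∞} {δ : ℝ} {K : ℝ≥0∞} (hK : K ≠ ∞)
    (h : ∀ᵐ ω ∂μ, ENNReal.ofReal (F ω) ≤ ENNReal.ofReal δ + K * G ω) :
    ∫⁻ ω, ENNReal.ofReal (F ω) ∂μ ≤ ENNReal.ofReal δ + K * ∫⁻ ω, G ω ∂μ := by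
  calc ∫⁻ ω, ENNReal.ofReal (F ω) ∂μ ≤ ∫⁻ ω, ENNReal.ofReal δ + K * G ω ∂μ := lintegral_mono_ae h
    _ = ENNReal.ofReal δ + K * ∫⁻ ω, G ω ∂μ := by
        rw [lintegral_add_left measurable_const, lintegral_const, measure_univ, mul_one,
          lintegral_const_mul' K _ hK]

/-- **In-law integration step (Bochner currency).** If a.s. `F ≤ δ + K G` with `G ≥ 0` a.s.
integrable of mean `≤ ε` (`δ, K ≥ 0`), then `∫⁻ ofReal F ≤ ofReal (δ + K ε)`. -/
theorem lintegral_ofReal_le_of_integral_le {Ω : Type*} [MeasurableSpace Ω] {μ : Measure Ω}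
    [IsProbabilityMeasure μ] {F G : Ω → ℝ} {δ K ε : ℝ} (hδ : 0 ≤ δ) (hK : 0 ≤ K)
    (hG : Integrable G μ) (hG0 : 0 ≤ᵐ[μ] G) (hFG : ∀ᵐ ω ∂μ, F ω ≤ δ + K * G ω)
    (hε : ∫ ω, G ω ∂μ ≤ ε) :
    ∫⁻ ω, ENNReal.ofReal (F ω) ∂μ ≤ ENNReal.ofReal (δ + K * ε) := by
  have hint : Integrable (fun ω => δ + K * G ω) μ := (integrable_const δ).add (hG.const_mul K)
  have hnn : 0 ≤ᵐ[μ] fun ω => δ + K * G ω := by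
    filter_upwards [hG0] with ω hω
    exact add_nonneg hδ (mul_nonneg hK hω)
  calc ∫⁻ ω, ENNReal.ofReal (F ω) ∂μ ≤ ∫⁻ ω, ENNReal.ofReal (δ + K * G ω) ∂μ :=
        lintegral_mono_ae (hFG.mono fun ω hω => ENNReal.ofReal_le_ofReal hω)
    _ = ENNReal.ofReal (∫ ω, (δ + K * G ω) ∂μ) := (ofReal_integral_eq_lintegral_ofReal hint hnn).symm
    _ ≤ ENNReal.ofReal (δ + K * ε) := by
        refine ENNReal.ofReal_le_ofReal ?_
        rw [integral_add (integrable_const δ) (hG.const_mul K), integral_const, integral_const_mul]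
        simp only [probReal_univ, one_smul]
        nlinarith

/-! ### The registered helper stub bundling toolbox B -/

/-- **Registered helper stub `s3bIntegrationToolbox`** (crux stmt-AtomisticToContinuum-9258, line
`registered`; integration bookkeeping of step S3b): (1) the pathwise step on `𝕋³`; (2) the in-law
step in the lower-integral currency; (3) the in-law step in the Bochner currency — both for the
local Gibbs laws whenever they are probability measures (`σ ≤ 1/2`). -/
def Sig.s3bIntegrationToolbox : Prop :=
  (∀ (f h : T3 → ℝ) (δ K : ℝ), 0 ≤ K → (∀ x, 0 ≤ f x) → (∀ x, f x ≤ δ + K * h x) →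
      ENNReal.ofReal (∫ x, f x) ≤
        ENNReal.ofReal δ + ENNReal.ofReal K * ∫⁻ x, ENNReal.ofReal (h x)) ∧
  (∀ (σ : ℝ) (a₀ : T3 → ℝ) (u₀ : T3 → V3) (θ₀ : T3 → ℝ) (N : ℕ)
      (Φ : HardSphereFlow (Literature.Analysis.FluidPDE.Torus.geometry (Fin 3)) (hsDiameter σ N) (N + 1)),
      IsProbabilityMeasure (localGibbsLaw σ a₀ u₀ θ₀ N Φ) →
      ∀ (F : Config (N + 1) (Fin 3) T3 → ℝ) (G : Config (N + 1) (Fin 3) T3 → ℝ≥0∞) (δ : ℝ) (K : ℝ≥0∞),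
        K ≠ ∞ → (∀ᵐ z ∂(localGibbsLaw σ a₀ u₀ θ₀ N Φ), ENNReal.ofReal (F z) ≤ ENNReal.ofReal δ + K * G z) →
        ∫⁻ z, ENNReal.ofReal (F z) ∂(localGibbsLaw σ a₀ u₀ θ₀ N Φ) ≤
          ENNReal.ofReal δ + K * ∫⁻ z, G z ∂(localGibbsLaw σ a₀ u₀ θ₀ N Φ)) ∧
  (∀ (σ : ℝ) (a₀ : T3 → ℝ) (u₀ : T3 → V3) (θ₀ : T3 → ℝ) (N : ℕ)
      (Φ : HardSphereFlow (Literature.Analysis.FluidPDE.Torus.geometry (Fin 3)) (hsDiameter σ N) (N + 1)),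
      IsProbabilityMeasure (localGibbsLaw σ a₀ u₀ θ₀ N Φ) →
      ∀ (F G : Config (N + 1) (Fin 3) T3 → ℝ) (δ K ε : ℝ), 0 ≤ δ → 0 ≤ K →
        Integrable G (localGibbsLaw σ a₀ u₀ θ₀ N Φ) → 0 ≤ᵐ[localGibbsLaw σ a₀ u₀ θ₀ N Φ] G →
        (∀ᵐ z ∂(localGibbsLaw σ a₀ u₀ θ₀ N Φ), F z ≤ δ + K * G z) →
        ∫ z, G z ∂(localGibbsLaw σ a₀ u₀ θ₀ N Φ) ≤ ε →
        ∫⁻ z, ENNReal.ofReal (F z) ∂(localGibbsLaw σ a₀ u₀ θ₀ N Φ) ≤ ENNReal.ofReal (δ + K * ε))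

/-- **Proof of the registered helper stub `s3bIntegrationToolbox`.** -/
theorem s3bIntegrationToolbox : Sig.s3bIntegrationToolbox :=
  ⟨fun _f _h _δ _K hK hf hle => ofReal_integral_le_add_mul_lintegral hK hf hle,
    fun _σ _a₀ _u₀ _θ₀ _N _Φ _ _F _G _δ _K hK h => lintegral_ofReal_le_of_ae_le hK h,
    fun _σ _a₀ _u₀ _θ₀ _N _Φ _ _F _G _δ _K _ε hδ hK hG hG0 hFG hε =>
      lintegral_ofReal_le_of_integral_le hδ hK hG hG0 hFG hε⟩

end Summit.AtomisticToContinuum.HydrodynamicLimit.Theorems.AWS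

end
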